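import Literature.Probability.Percolation.ZdFourArmSepInwardExtProb
import Literature.Probability.Percolation.ZdFiveArmSeparatedE
import HarnessLib

/-!
# Inward extension of Kesten's well-separated five-arm event `zdFiveArmSepE` (bond percolation on `ℤ²`), deterministic half

Topic `Literature/Probability/Percolation`; critical bond percolation on `ℤ²`
(`bondPercolation (zdGraph 2) half`). Proofs and two auxiliary event definitions (no named fact).

A brick of the INTERNAL half of Kesten's arm-separation scheme for FIVE arms (input `(ext)` of
`DuminilCopinManolescuTassion2021_zdFiveArm_upperBound_of_separationInputs`,
`ZdFiveArmUpperBoundOfScheme.lean`): the extension of the fully fenced event when the inner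
radius is halved,

  `zdFiveArmSepE m N ∩ (extension events in B(m-1)) ⊆ zdFiveArmSepE m' N`   (`64 ≤ m'`, `2m' ≤ m ≤ 4m'`, `2m ≤ N`),

following the four-arm file `ZdFourArmSepInwardExt.lean` (Nolin 2008, §4.3 Prop. 12 (i): "once
well-separated, the arms can easily be extended"; Kesten 1987, Lemma 5), whose rebuilt left arm and
dual arms (`ZdSepOpenArmL.inward`, `ZdSepDualArmT.inward`, `ZdSepDualArmB.inward`, events
`inwardOpenEvents`, `inwardDualEvents`) are reused verbatim.  New here: the two RIGHT arms `R⁺`,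
`R⁻` of `zdSepOpenPairRE` land at heights `±[m/4, m/4 + m/64]`, so their extensions to radius `m'`
run through BENT corridors (a thin corridor at the new heights `±[m'/4, m'/4 + m'/64]` from the
column `m'`, a tall joint, a thin corridor at the old heights up to the old inner fence), with a
row-shifted copy of the new inner fence (`exists_inwardFence_R_rows`); and the EDGE-disjointness
of the two rebuilt right arms (old pieces are edge-disjoint by hypothesis, new pieces live in
boxes of rows `≥ 1` resp. `≤ -1` inside `B(m-1)`, off the old carriers).

* `exists_inwardFence_R_rows`, `ZdSepOpenArmR.exists_inwardBody_bent`, `ZdSepOpenArmR.inward_bent`;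
* `inwardRpEvents m m'`, `inwardRmEvents m m'` — the six extension crossings of each right arm;
* **`mem_zdFiveArmSepE_of_mem_inward5`** —
  `zdFiveArmSepE m N ∩ (inwardOpenEvents m m' ∩ inwardRpEvents m m' ∩ inwardRmEvents m m') ∩ inwardDualEvents m m' ⊆ zdFiveArmSepE m' N`
  on lattice configurations.

## References

* P. Nolin, *Near-critical percolation in two dimensions*, EJP 13 (2008), §4.3 Prop. 12 (i),
  Lemma 13, §4.4 part 2 [arXiv 0711.4948: Prop. 11, Lemma 12, pp. 12–13]. [Nolin2008]
* H. Kesten, *Scaling relations for 2D-percolation*, CMP 109 (1987), §2, Lemma 5, (2.43).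
  [KestenScalingCMP1987]
-/

noncomputable section

open MeasureTheory Set SimpleGraph

namespace Literature.Probability.Percolation

open LatticeModels

variable {ω : BondConfig (Site 2)} {m m' N : ℕ} {lo hi lo' hi' : ℤ}

/-! ### Inner gluing with support and edge bookkeeping -/

/-- `ZdSepOpenArmR.exists_walk_of_innerCorridorE` with the support located on the inner attaching
walk `P'` and the inner fence crossing `V'` (finer than the carrier). [cite: Nolin2008, §4.3, proof of Prop. 12 (arXiv 0711.4948: Prop. 11)] -/
theorem ZdSepOpenArmR.exists_walk_of_innerCorridorPV {n : ℕ} {B₀ B₁ : ℤ} {s y : Site 2}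
    (A : ZdSepOpenArmR ω n N B₀ B₁ lo' hi') (hB₁ : B₁ = B₀ + (n / 64 : ℕ))
    (he : 1 ≤ n / 8) (T : (zdGraph 2).Walk s y) (hy : y 0 + 1 = n) (hs : s 0 ≤ (n : ℤ) - (n / 8 : ℕ))
    (hT : ∀ z ∈ T.support, z 0 + 1 ≤ n ∧ ((n : ℤ) - (n / 8 : ℕ) ≤ z 0 → B₀ ≤ z 1 ∧ z 1 ≤ B₀ + (n / 64 : ℕ))) :
    ∃ mt ∈ T.support, ∃ U : (zdGraph 2).Walk A.x mt,
      (∀ z ∈ U.support, z ∈ A.P'.support ∨ z ∈ A.V'.support) ∧ (∀ e ∈ U.edges, e ∈ A.edgeCarrier) ∧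
        ∀ e ∈ U.edges, e ∈ ω := by
  subst hB₁
  obtain ⟨q, T₁, hq, hT₁s, -⟩ :=
    exists_prefix_reach_le 0 T.reverse ((n : ℤ) - (n / 8 : ℕ)) (by omega) hs
  have hbox : ∀ z ∈ T₁.reverse.support, (n : ℤ) - (n / 8 : ℕ) ≤ z 0 ∧ z 0 ≤ (n : ℤ) - 1 ∧
      B₀ ≤ z 1 ∧ z 1 ≤ B₀ + (n / 64 : ℕ) := by
    intro z hz
    rw [Walk.support_reverse, List.mem_reverse] at hz
    obtain ⟨h1, h2⟩ := hT₁s z hz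
    rw [Walk.support_reverse, List.mem_reverse] at h2
    obtain ⟨h3, h4⟩ := hT z h2
    exact ⟨h1, by omega, h4 h1⟩
  have hx := A.hx
  obtain ⟨mt, hmT, hmV⟩ := exists_mem_support_of_vFence (L := (n : ℤ) - (n / 8 : ℕ)) (R := (n : ℤ) - 1)
    (B₀ := B₀) (B₁ := B₀ + (n / 64 : ℕ)) A.V' (fun z hz => ⟨(A.hV' z hz).1, by have := (A.hV' z hz).2.1; omega⟩)
    (by rw [A.hab'.1]; omega) (by rw [A.hab'.2]; omega) (by omega) T₁.reverse hq (by omega) hbox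
  obtain ⟨Uv, hUvs, hUve⟩ := exists_walk_within_support A.V' A.hu' hmV
  have hmT' : mt ∈ T.support := by
    rw [Walk.support_reverse, List.mem_reverse] at hmT
    have := (hT₁s mt hmT).2
    rwa [Walk.support_reverse, List.mem_reverse] at this
  refine ⟨mt, hmT', A.P'.append Uv, fun z hz => ?_, fun e he => ?_, fun e he => ?_⟩
  · rw [Walk.mem_support_append_iff] at hz
    rcases hz with hz | hz
    · exact Or.inl hz
    · exact Or.inr (hUvs z hz)
  · rw [Walk.edges_append, List.mem_append] at he
    rcases he with he | he
    · exact Or.inr (Or.inr (Or.inr (Or.inr he)))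
    · exact Or.inr (Or.inr (Or.inr (Or.inl (hUve e he))))
  · rw [Walk.edges_append, List.mem_append] at he
    rcases he with he | he
    · exact A.hP'o e he
    · exact A.hV'o e (hUve e he)

/-! ### The new inner fence in a prescribed row band -/

/-- Numerical bound for the new attaching walks in the row band `[r, r + m'/64]`. [folklore] -/
theorem attachBound_R_rows {m' : ℕ} (hm' : 64 ≤ m') {r v0 v1 s0 s1 : ℤ} (hs0 : s0 = m')
    (hs1 : r ≤ s1 ∧ s1 ≤ r + (m' / 64 : ℕ))
    (h0 : (m' : ℤ) - (m' / 8 : ℕ) + 1 ≤ v0) (h0' : v0 ≤ (m' : ℤ) + (m' / 16 : ℕ))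
    (h1 : r - ((m' / 64 : ℕ) : ℤ) ≤ v1) (h1' : v1 ≤ r + 2 * ((m' / 64 : ℕ) : ℤ)) :
    |v0 - s0| + 1 ≤ (m' / 8 : ℕ) ∧ |v1 - s1| + 1 ≤ (m' / 8 : ℕ) := by
  have e1 : m' / 16 + 2 ≤ m' / 8 := by omega
  have e2 : 2 * (m' / 64) + 1 ≤ m' / 8 := by omega
  have e1' : ((m' / 16 : ℕ) : ℤ) + 2 ≤ (m' / 8 : ℕ) := by exact_mod_cast e1
  have e2' : 2 * ((m' / 64 : ℕ) : ℤ) + 1 ≤ (m' / 8 : ℕ) := by exact_mod_cast e2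
  constructor
  · have : |v0 - s0| ≤ ((m' / 8 : ℕ) : ℤ) - 1 := abs_sub_le_iff.2 ⟨by omega, by omega⟩
    omega
  · have : |v1 - s1| ≤ 2 * ((m' / 64 : ℕ) : ℤ) := abs_sub_le_iff.2 ⟨by omega, by omega⟩
    omega

/-- **The new inner fence of a right arm in the row band `[r, r + m'/64]`** (row-shifted copy of
`exists_inwardFence_R`): from the corridor crossing `H` (used near its start `s`, `s₀ = m'`,
`r ≤ s₁ ≤ r + m'/64`), an open left–right crossing `H₀` of `[m'-m'/8+1, m'+m'/16] × [r, r + m'/64]`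
and open top–bottom crossings `V₀` of `[m'+1, m'+m'/16] × [r - m'/64, r + 2·m'/64]`, `V₁` of
`[m'-m'/8+1, m'-1] × [r - m'/64, r + 2·m'/64]`: a crossing of the fence box
`[m'-m'/8, m'-1] × [s₁ ∓ m'/64]` and an open attaching walk from `s` within sup-distance `< m'/8`.
[cite: Nolin2008, §4.2 Def. 6 (free spaces) and §4.3 proof of Prop. 12 (i) (arXiv 0711.4948)] -/
theorem exists_inwardFence_R_rows (hm' : 64 ≤ m') {r X : ℤ} (hX : (m' : ℤ) + (m' / 16 : ℕ) ≤ X)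
    {s y : Site 2} (H : (zdGraph 2).Walk s y) (hs : s 0 = m') (hy : y 0 = X)
    (hH : ∀ z ∈ H.support, (m' : ℤ) ≤ z 0 ∧ z 0 ≤ X ∧ r ≤ z 1 ∧ z 1 ≤ r + (m' / 64 : ℕ))
    (hHo : ∀ e ∈ H.edges, e ∈ ω)
    {s₀ y₀ : Site 2} (H₀ : (zdGraph 2).Walk s₀ y₀) (hs₀ : s₀ 0 = (m' : ℤ) - (m' / 8 : ℕ) + 1)
    (hy₀ : y₀ 0 = (m' : ℤ) + (m' / 16 : ℕ))
    (hH₀ : ∀ z ∈ H₀.support, (m' : ℤ) - (m' / 8 : ℕ) + 1 ≤ z 0 ∧ z 0 ≤ (m' : ℤ) + (m' / 16 : ℕ) ∧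
      r ≤ z 1 ∧ z 1 ≤ r + (m' / 64 : ℕ))
    (hH₀o : ∀ e ∈ H₀.edges, e ∈ ω)
    {p₀ q₀ : Site 2} (V₀ : (zdGraph 2).Walk p₀ q₀) (hp₀ : p₀ 1 = r - ((m' / 64 : ℕ) : ℤ))
    (hq₀ : q₀ 1 = r + 2 * ((m' / 64 : ℕ) : ℤ))
    (hV₀ : ∀ z ∈ V₀.support, (m' : ℤ) + 1 ≤ z 0 ∧ z 0 ≤ (m' : ℤ) + (m' / 16 : ℕ) ∧
      r - ((m' / 64 : ℕ) : ℤ) ≤ z 1 ∧ z 1 ≤ r + 2 * ((m' / 64 : ℕ) : ℤ))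
    (hV₀o : ∀ e ∈ V₀.edges, e ∈ ω)
    {p₁ q₁ : Site 2} (V₁ : (zdGraph 2).Walk p₁ q₁) (hp₁ : p₁ 1 = r - ((m' / 64 : ℕ) : ℤ))
    (hq₁ : q₁ 1 = r + 2 * ((m' / 64 : ℕ) : ℤ))
    (hV₁ : ∀ z ∈ V₁.support, (m' : ℤ) - (m' / 8 : ℕ) + 1 ≤ z 0 ∧ z 0 + 1 ≤ (m' : ℤ) ∧
      r - ((m' / 64 : ℕ) : ℤ) ≤ z 1 ∧ z 1 ≤ r + 2 * ((m' / 64 : ℕ) : ℤ))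
    (hV₁o : ∀ e ∈ V₁.edges, e ∈ ω) :
    ∃ (a' b' u' : Site 2) (V' : (zdGraph 2).Walk a' b') (P' : (zdGraph 2).Walk s u'),
      (a' 1 = s 1 - (m' / 64 : ℕ) ∧ b' 1 = s 1 + (m' / 64 : ℕ)) ∧
      (∀ v ∈ V'.support, (m' : ℤ) - (m' / 8 : ℕ) ≤ v 0 ∧ v 0 + 1 ≤ m' ∧ |v 1 - s 1| ≤ (m' / 64 : ℕ)) ∧
      (∀ e ∈ V'.edges, e ∈ ω) ∧ u' ∈ V'.support ∧
      (∀ v ∈ P'.support, |v 0 - s 0| + 1 ≤ (m' / 8 : ℕ) ∧ |v 1 - s 1| + 1 ≤ (m' / 8 : ℕ)) ∧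
      (∀ e ∈ P'.edges, e ∈ ω) ∧
      (∀ v ∈ V'.support, v ∈ V₁.support) ∧
      (∀ v ∈ P'.support, v ∈ H.support ∨ v ∈ V₀.support ∨ v ∈ H₀.support) := by
  classical
  have hs1 := hH s H.start_mem_support
  have h16 : 1 ≤ m' / 16 := by omega
  -- the fence crossing: the segment of `V₁` across the rows `[s₁ - m'/64, s₁ + m'/64]`
  obtain ⟨a', b', Vs, ha', hb', hVs, hVse⟩ := exists_segment_between 1 V₁ (s 1 - (m' / 64 : ℕ))
    (s 1 + (m' / 64 : ℕ)) (by rw [hp₁]; omega) (by rw [hq₁]; omega) (by omega)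
  -- `H₀` up to the column `m' - 1` meets it
  obtain ⟨qh, H₀p, hqh, hH₀p, -⟩ := exists_prefix_reach_ge 0 H₀ ((m' : ℤ) - 1) (by rw [hs₀]; omega)
    (by rw [hy₀]; omega)
  obtain ⟨u', hu'H, hu'V⟩ := exists_mem_support_of_vFence (L := (m' : ℤ) - (m' / 8 : ℕ) + 1)
    (R := (m' : ℤ) - 1) (B₀ := r) (B₁ := r + ((m' / 64 : ℕ) : ℤ)) Vs
    (fun z hz => ⟨(hV₁ z (hVs z hz).2.2).1, by have := (hV₁ z (hVs z hz).2.2).2.1; omega⟩)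
    (by rw [ha']; omega) (by rw [hb']; omega) (by omega) H₀p hs₀ hqh
    (fun z hz => ⟨(hH₀ z (hH₀p z hz).2).1, (hH₀p z hz).1, (hH₀ z (hH₀p z hz).2).2.2.1,
      (hH₀ z (hH₀p z hz).2).2.2.2⟩)
  -- `H₀` between the columns `m' + 1` and `m' + m'/16` meets `V₀`
  obtain ⟨pa, pb, H₀s, hpa, hpb, hH₀s, -⟩ := exists_segment_between 0 H₀ ((m' : ℤ) + 1)
    ((m' : ℤ) + (m' / 16 : ℕ)) (by rw [hs₀]; omega) (by rw [hy₀]) (by omega)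
  obtain ⟨v₁, hv₁H, hv₁V⟩ := exists_mem_support_of_vFence (L := (m' : ℤ) + 1)
    (R := (m' : ℤ) + (m' / 16 : ℕ)) (B₀ := r) (B₁ := r + ((m' / 64 : ℕ) : ℤ)) V₀
    (fun z hz => ⟨(hV₀ z hz).1, (hV₀ z hz).2.1⟩) (by rw [hp₀]; omega) (by rw [hq₀]; omega) (by omega)
    H₀s hpa hpb (fun z hz => ⟨(hH₀s z hz).1, (hH₀s z hz).2.1, (hH₀ z (hH₀s z hz).2.2).2.2.1,
      (hH₀ z (hH₀s z hz).2.2).2.2.2⟩)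
  -- `H` up to the column `m' + m'/16` meets `V₀`
  obtain ⟨qH, Hp, hqH, hHp, hHpe⟩ := exists_prefix_reach_ge 0 H ((m' : ℤ) + (m' / 16 : ℕ))
    (by rw [hs]; omega) (by rw [hy]; omega)
  obtain ⟨ra, rb, Hps, hra, hrb, hHps, -⟩ := exists_segment_between 0 Hp ((m' : ℤ) + 1)
    ((m' : ℤ) + (m' / 16 : ℕ)) (by rw [hs]; omega) (by rw [hqH]) (by omega)
  obtain ⟨v₀, hv₀H, hv₀V⟩ := exists_mem_support_of_vFence (L := (m' : ℤ) + 1)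
    (R := (m' : ℤ) + (m' / 16 : ℕ)) (B₀ := r) (B₁ := r + ((m' / 64 : ℕ) : ℤ)) V₀
    (fun z hz => ⟨(hV₀ z hz).1, (hV₀ z hz).2.1⟩) (by rw [hp₀]; omega) (by rw [hq₀]; omega) (by omega)
    Hps hra hrb (fun z hz => ⟨(hHps z hz).1, (hHps z hz).2.1, (hH z ((hHp z (hHps z hz).2.2).2)).2.2.1,
      (hH z ((hHp z (hHps z hz).2.2).2)).2.2.2⟩)
  -- the attaching walk
  have hv₀Hp : v₀ ∈ Hp.support := (hHps v₀ hv₀H).2.2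
  obtain ⟨X₁, hX₁s, hX₁e⟩ := exists_walk_within_support V₀ hv₀V hv₁V
  obtain ⟨X₂, hX₂s, hX₂e⟩ := exists_walk_within_support H₀ (hH₀s v₁ hv₁H).2.2 (hH₀p u' hu'H).2
  refine ⟨a', b', u', Vs, (Hp.takeUntil v₀ hv₀Hp).append (X₁.append X₂), ⟨ha', hb'⟩,
    fun v hv => ?_, fun e he => hV₁o e (hVse e he), hu'V, fun v hv => ?_, fun e he => ?_,
    fun v hv => (hVs v hv).2.2, fun v hv => ?_⟩
  · obtain ⟨h1, h1', hv'⟩ := hVs v hv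
    obtain ⟨h0, h0', -, -⟩ := hV₁ v hv'
    exact ⟨by omega, by omega, abs_le.2 ⟨by omega, by omega⟩⟩
  · rw [Walk.mem_support_append_iff, Walk.mem_support_append_iff] at hv
    rcases hv with hv | hv | hv
    · have h := hHp v (Hp.support_takeUntil_subset_support hv₀Hp hv)
      obtain ⟨h0, -, h1, h1'⟩ := hH v h.2
      exact attachBound_R_rows hm' hs ⟨hs1.2.2.1, hs1.2.2.2⟩ (by omega) h.1 (by omega) (by omega)
    · obtain ⟨h0, h0', h1, h1'⟩ := hV₀ v (hX₁s v hv)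
      exact attachBound_R_rows hm' hs ⟨hs1.2.2.1, hs1.2.2.2⟩ (by omega) h0' h1 h1'
    · obtain ⟨h0, h0', h1, h1'⟩ := hH₀ v (hX₂s v hv)
      exact attachBound_R_rows hm' hs ⟨hs1.2.2.1, hs1.2.2.2⟩ h0 h0' (by omega) (by omega)
  · rw [Walk.edges_append, List.mem_append, Walk.edges_append, List.mem_append] at he
    rcases he with he | he | he
    · exact hHo e (hHpe e (Hp.edges_takeUntil_subset_edges hv₀Hp he))
    · exact hV₀o e (hX₁e e he)
    · exact hH₀o e (hX₂e e he)
  · rw [Walk.mem_support_append_iff, Walk.mem_support_append_iff] at hv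
    rcases hv with hv | hv | hv
    · exact Or.inl (hHp v (Hp.support_takeUntil_subset_support hv₀Hp hv)).2
    · exact Or.inr (Or.inl (hX₁s v hv))
    · exact Or.inr (Or.inr (hX₂s v hv))

/-! ### The bent new body of a right arm -/

/-- **The bent new body of a right arm.**  From a fenced right arm `A` of `A_{m,N}` with inner landing
rows `[lo, lo + m/64]`, a thin open corridor crossing `Ha` of `[m', m'+m'/2] × [r, r + m'/64]` from
the column `m'`, a tall open top–bottom crossing `Vb` of `[m'+m'/4, m'+m'/2] × [Bot, Top]` (rows
covering both bands) and a thin open corridor crossing `Hc` of `[m'+m'/4, m-1] × [lo, lo + m/64]`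
up to the column `m - 1` (`64 ≤ m'`, `2m' ≤ m`, `2m ≤ N`): an open walk of `A_{m',N}` from the start
of `Ha` to the outer endpoint of `A` (along `Ha` to `Vb`, along `Vb` to `Hc`, along `Hc` to the old
inner fence, old attaching walk reversed, old body), each of whose edges is an edge of the old
carrier or has both endpoints in `[m', m-1] × [Bot, Top]`. [cite: Nolin2008, §4.3, proof of Prop. 12 (i) (arXiv 0711.4948: Prop. 11)] -/
theorem ZdSepOpenArmR.exists_inwardBody_bent (A : ZdSepOpenArmR ω m N lo hi lo' hi') (hhi : hi = lo + (m / 64 : ℕ))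
    (hm' : 64 ≤ m') (h2 : 2 * m' ≤ m) (hN : 2 * m ≤ N)
    {r Bot Top : ℤ} (hBot : Bot ≤ r ∧ Bot ≤ lo) (hTop : r + (m' / 64 : ℕ) ≤ Top ∧ lo + (m / 64 : ℕ) ≤ Top)
    (hBN : -(N : ℤ) ≤ Bot) (hTN : Top ≤ N) (hloN : |lo| + (m / 64 : ℕ) + (m / 8 : ℕ) ≤ N)
    {sa ya : Site 2} (Ha : (zdGraph 2).Walk sa ya) (hsa : sa 0 = m') (hya : ya 0 = (m' : ℤ) + (m' / 2 : ℕ))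
    (hHa : ∀ z ∈ Ha.support, (m' : ℤ) ≤ z 0 ∧ z 0 ≤ (m' : ℤ) + (m' / 2 : ℕ) ∧ r ≤ z 1 ∧ z 1 ≤ r + (m' / 64 : ℕ))
    (hHao : ∀ e ∈ Ha.edges, e ∈ ω)
    {pb qb : Site 2} (Vb : (zdGraph 2).Walk pb qb) (hpb : pb 1 = Bot) (hqb : qb 1 = Top)
    (hVb : ∀ z ∈ Vb.support, (m' : ℤ) + (m' / 4 : ℕ) ≤ z 0 ∧ z 0 ≤ (m' : ℤ) + (m' / 2 : ℕ) ∧ Bot ≤ z 1 ∧ z 1 ≤ Top)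
    (hVbo : ∀ e ∈ Vb.edges, e ∈ ω)
    {sc yc : Site 2} (Hc : (zdGraph 2).Walk sc yc) (hsc : sc 0 = (m' : ℤ) + (m' / 4 : ℕ)) (hyc : yc 0 + 1 = m)
    (hHc : ∀ z ∈ Hc.support, (m' : ℤ) + (m' / 4 : ℕ) ≤ z 0 ∧ z 0 + 1 ≤ m ∧ lo ≤ z 1 ∧ z 1 ≤ lo + (m / 64 : ℕ))
    (hHco : ∀ e ∈ Hc.edges, e ∈ ω) :
    ∃ W' : (zdGraph 2).Walk sa A.z, (∀ v ∈ W'.support, v ∈ sqAnnulus m' N) ∧ (∀ e ∈ W'.edges, e ∈ ω) ∧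
      ∀ e ∈ W'.edges, e ∈ A.edgeCarrier ∨
        ∀ v ∈ e, (m' : ℤ) ≤ v 0 ∧ v 0 + 1 ≤ m ∧ Bot ≤ v 1 ∧ v 1 ≤ Top := by
  classical
  subst hhi
  have hx := A.hx
  have hm'1 : 1 ≤ m' := by omega
  have h8 : 1 ≤ m / 8 := by omega
  have hq4 : ((m' / 4 : ℕ) : ℤ) ≤ (m' / 2 : ℕ) := by exact_mod_cast (Nat.div_le_div_left (by norm_num) (by norm_num) : m' / 4 ≤ m' / 2)
  have hsc8 : (m' : ℤ) + (m' / 4 : ℕ) ≤ (m : ℤ) - (m / 8 : ℕ) := by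
    have h1 : m' + m' / 4 + m / 8 ≤ m := by omega
    have h2 := (Nat.cast_le (α := ℤ)).2 h1
    simp only [Nat.cast_add] at h2
    linarith
  have hN8 : ((m / 8 : ℕ) : ℤ) ≤ m := by exact_mod_cast Nat.div_le_self m 8
  -- `Ha` meets `Vb`
  obtain ⟨j₁, hj₁H, hj₁V⟩ := exists_mem_support_of_vFence (L := (m' : ℤ)) (R := (m' : ℤ) + (m' / 2 : ℕ))
    (B₀ := r) (B₁ := r + ((m' / 64 : ℕ) : ℤ)) Vb (fun z hz => ⟨by have := (hVb z hz).1; omega, (hVb z hz).2.1⟩)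
    (by rw [hpb]; exact hBot.1) (by rw [hqb]; exact hTop.1) (by omega) Ha hsa hya hHa
  -- `Hc` up to the column `m' + m'/2` meets `Vb`
  obtain ⟨qc, Hcp, hqc, hHcp, -⟩ := exists_prefix_reach_ge 0 Hc ((m' : ℤ) + (m' / 2 : ℕ)) (by rw [hsc]; omega)
    (by have := (hHc yc Hc.end_mem_support).2.1; omega)
  obtain ⟨j₂, hj₂H, hj₂V⟩ := exists_mem_support_of_vFence (L := (m' : ℤ) + (m' / 4 : ℕ))
    (R := (m' : ℤ) + (m' / 2 : ℕ)) (B₀ := lo) (B₁ := lo + ((m / 64 : ℕ) : ℤ)) Vb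
    (fun z hz => ⟨(hVb z hz).1, (hVb z hz).2.1⟩) (by rw [hpb]; exact hBot.2) (by rw [hqb]; exact hTop.2)
    (by omega) Hcp hsc hqc
    (fun z hz => ⟨(hHc z (hHcp z hz).2).1, (hHcp z hz).1, (hHc z (hHcp z hz).2).2.2.1, (hHc z (hHcp z hz).2).2.2.2⟩)
  have hj₂Hc : j₂ ∈ Hc.support := (hHcp j₂ hj₂H).2
  -- `Hc` reaches the old inner fence
  obtain ⟨mt, hmt, U, hUs, hUe, hUo⟩ := A.exists_walk_of_innerCorridorPV rfl h8 Hc hyc (by rw [hsc]; exact hsc8)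
    (fun z hz => ⟨(hHc z hz).2.1, fun _ => ⟨(hHc z hz).2.2.1, (hHc z hz).2.2.2⟩⟩)
  -- the joints
  obtain ⟨Q₁, hQ₁s, hQ₁e⟩ := exists_walk_within_support Vb hj₁V hj₂V
  obtain ⟨Q₂, hQ₂s, hQ₂e⟩ := exists_walk_within_support Hc hj₂Hc hmt
  refine ⟨(Ha.takeUntil j₁ hj₁H).append (Q₁.append (Q₂.append (U.reverse.append A.W))),
    fun v hv => ?_, fun e he => ?_, fun e he => ?_⟩
  · simp only [Walk.mem_support_append_iff, Walk.support_reverse, List.mem_reverse] at hv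
    rcases hv with hv | hv | hv | hv | hv
    · obtain ⟨h0, h0', h1, h1'⟩ := hHa v (Ha.support_takeUntil_subset_support hj₁H hv)
      exact mem_sqAnnulus_of_bounds hm'1 (by omega) (by omega) (by omega) (by omega) (Or.inl h0)
    · obtain ⟨h0, h0', h1, h1'⟩ := hVb v (hQ₁s v hv)
      exact mem_sqAnnulus_of_bounds hm'1 (by omega) (by omega) (by omega) (by omega) (Or.inl (by omega))
    · obtain ⟨h0, h0', h1, h1'⟩ := hHc v (hQ₂s v hv)
      exact mem_sqAnnulus_of_bounds hm'1 (by omega) (by omega) (by omega) (by omega) (Or.inl (by omega))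
    · rcases hUs v hv with h | h
      · obtain ⟨a0, a1⟩ := A.hP' v h
        have b0 := abs_le.1 (show |v 0 - A.x 0| ≤ (m / 8 : ℕ) - 1 by omega)
        have b1 := abs_le.1 (show |v 1 - A.x 1| ≤ (m / 8 : ℕ) - 1 by omega)
        have hl := abs_le.1 (show |lo| ≤ (N : ℤ) - (m / 64 : ℕ) - (m / 8 : ℕ) by omega)
        exact mem_sqAnnulus_of_bounds hm'1 (by omega) (by omega) (by omega) (by omega) (Or.inl (by omega))
      · obtain ⟨a0, a0', a1⟩ := A.hV' v h
        have b1 := abs_le.1 a1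
        have hl := abs_le.1 (show |lo| ≤ (N : ℤ) - (m / 64 : ℕ) - (m / 8 : ℕ) by omega)
        exact mem_sqAnnulus_of_bounds hm'1 (by omega) (by omega) (by omega) (by omega) (Or.inl (by omega))
    · exact sqAnnulus_mono (by omega) le_rfl (A.hW v hv)
  · simp only [Walk.edges_append, List.mem_append, Walk.edges_reverse, List.mem_reverse] at he
    rcases he with he | he | he | he | he
    · exact hHao e (Ha.edges_takeUntil_subset_edges hj₁H he)
    · exact hVbo e (hQ₁e e he)
    · exact hHco e (hQ₂e e he)
    · exact hUo e he
    · exact A.hWo e he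
  · simp only [Walk.edges_append, List.mem_append, Walk.edges_reverse, List.mem_reverse] at he
    rcases he with he | he | he | he | he
    · refine Or.inr fun v hv => ?_
      obtain ⟨h0, h0', h1, h1'⟩ := hHa v (Ha.support_takeUntil_subset_support hj₁H
        (forall_mem_support_of_mem_edges _ he v hv))
      exact ⟨h0, by omega, by omega, by omega⟩
    · refine Or.inr fun v hv => ?_
      obtain ⟨h0, h0', h1, h1'⟩ := hVb v (hQ₁s v (forall_mem_support_of_mem_edges _ he v hv))
      exact ⟨by omega, by omega, h1, h1'⟩
    · refine Or.inr fun v hv => ?_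
      obtain ⟨h0, h0', h1, h1'⟩ := hHc v (hQ₂s v (forall_mem_support_of_mem_edges _ he v hv))
      exact ⟨by omega, h0', by omega, by omega⟩
    · exact Or.inl (hUe e he)
    · exact Or.inl (Or.inl he)

/-- **The rebuilt right arm at inner radius `m'` with bent corridor** (`64 ≤ m'`, `2m' ≤ m`,
`2m ≤ N`): from a fenced right arm of `A_{m,N}` with inner landing rows `[lo, lo + m/64]`, the
three body crossings of `exists_inwardBody_bent` and the three fence crossings of
`exists_inwardFence_R_rows` (row band `[r, r + m'/64]`), a fenced right arm of `A_{m',N}` with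
inner landing rows `[r, r + m'/64]` and the same outer landing data, each of whose carrier edges
is an edge of the old carrier or has both endpoints in `[m' - m'/8, m - 1] × [Bot ⊓ (r - m'/64), Top ⊔ (r + 2·m'/64)]`.
[cite: Nolin2008, §4.3 Prop. 12 (i) and §4.4 part 2 (arXiv 0711.4948: Prop. 11 (i), p. 13)] -/
theorem ZdSepOpenArmR.inward_bent (A : ZdSepOpenArmR ω m N lo hi lo' hi') (hhi : hi = lo + (m / 64 : ℕ))
    (hm' : 64 ≤ m') (h2 : 2 * m' ≤ m) (hN : 2 * m ≤ N)
    {r Bot Top lo₁ hi₁ : ℤ} (hlo₁ : lo₁ ≤ r) (hhi₁ : r + (m' / 64 : ℕ) ≤ hi₁)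
    (hBot : Bot ≤ r - ((m' / 64 : ℕ) : ℤ) ∧ Bot ≤ lo)
    (hTop : r + 2 * ((m' / 64 : ℕ) : ℤ) ≤ Top ∧ lo + (m / 64 : ℕ) ≤ Top)
    (hBN : -(N : ℤ) ≤ Bot) (hTN : Top ≤ N) (hloN : |lo| + (m / 64 : ℕ) + (m / 8 : ℕ) ≤ N)
    {sa ya : Site 2} (Ha : (zdGraph 2).Walk sa ya) (hsa : sa 0 = m') (hya : ya 0 = (m' : ℤ) + (m' / 2 : ℕ))
    (hHa : ∀ z ∈ Ha.support, (m' : ℤ) ≤ z 0 ∧ z 0 ≤ (m' : ℤ) + (m' / 2 : ℕ) ∧ r ≤ z 1 ∧ z 1 ≤ r + (m' / 64 : ℕ))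
    (hHao : ∀ e ∈ Ha.edges, e ∈ ω)
    {pb qb : Site 2} (Vb : (zdGraph 2).Walk pb qb) (hpb : pb 1 = Bot) (hqb : qb 1 = Top)
    (hVb : ∀ z ∈ Vb.support, (m' : ℤ) + (m' / 4 : ℕ) ≤ z 0 ∧ z 0 ≤ (m' : ℤ) + (m' / 2 : ℕ) ∧ Bot ≤ z 1 ∧ z 1 ≤ Top)
    (hVbo : ∀ e ∈ Vb.edges, e ∈ ω)
    {sc yc : Site 2} (Hc : (zdGraph 2).Walk sc yc) (hsc : sc 0 = (m' : ℤ) + (m' / 4 : ℕ)) (hyc : yc 0 + 1 = m)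
    (hHc : ∀ z ∈ Hc.support, (m' : ℤ) + (m' / 4 : ℕ) ≤ z 0 ∧ z 0 + 1 ≤ m ∧ lo ≤ z 1 ∧ z 1 ≤ lo + (m / 64 : ℕ))
    (hHco : ∀ e ∈ Hc.edges, e ∈ ω)
    {s₀ y₀ : Site 2} (H₀ : (zdGraph 2).Walk s₀ y₀) (hs₀ : s₀ 0 = (m' : ℤ) - (m' / 8 : ℕ) + 1)
    (hy₀ : y₀ 0 = (m' : ℤ) + (m' / 16 : ℕ))
    (hH₀ : ∀ z ∈ H₀.support, (m' : ℤ) - (m' / 8 : ℕ) + 1 ≤ z 0 ∧ z 0 ≤ (m' : ℤ) + (m' / 16 : ℕ) ∧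
      r ≤ z 1 ∧ z 1 ≤ r + (m' / 64 : ℕ))
    (hH₀o : ∀ e ∈ H₀.edges, e ∈ ω)
    {p₀ q₀ : Site 2} (V₀ : (zdGraph 2).Walk p₀ q₀) (hp₀ : p₀ 1 = r - ((m' / 64 : ℕ) : ℤ))
    (hq₀ : q₀ 1 = r + 2 * ((m' / 64 : ℕ) : ℤ))
    (hV₀ : ∀ z ∈ V₀.support, (m' : ℤ) + 1 ≤ z 0 ∧ z 0 ≤ (m' : ℤ) + (m' / 16 : ℕ) ∧
      r - ((m' / 64 : ℕ) : ℤ) ≤ z 1 ∧ z 1 ≤ r + 2 * ((m' / 64 : ℕ) : ℤ))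
    (hV₀o : ∀ e ∈ V₀.edges, e ∈ ω)
    {p₁ q₁ : Site 2} (V₁ : (zdGraph 2).Walk p₁ q₁) (hp₁ : p₁ 1 = r - ((m' / 64 : ℕ) : ℤ))
    (hq₁ : q₁ 1 = r + 2 * ((m' / 64 : ℕ) : ℤ))
    (hV₁ : ∀ z ∈ V₁.support, (m' : ℤ) - (m' / 8 : ℕ) + 1 ≤ z 0 ∧ z 0 + 1 ≤ (m' : ℤ) ∧
      r - ((m' / 64 : ℕ) : ℤ) ≤ z 1 ∧ z 1 ≤ r + 2 * ((m' / 64 : ℕ) : ℤ))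
    (hV₁o : ∀ e ∈ V₁.edges, e ∈ ω) :
    ∃ A' : ZdSepOpenArmR ω m' N lo₁ hi₁ lo' hi',
      ∀ e ∈ A'.edgeCarrier, e ∈ A.edgeCarrier ∨
        ∀ v ∈ e, (m' : ℤ) - (m' / 8 : ℕ) ≤ v 0 ∧ v 0 + 1 ≤ m ∧ Bot ≤ v 1 ∧ v 1 ≤ Top := by
  have hs1 := hHa sa Ha.start_mem_support
  have h16 : ((m' / 16 : ℕ) : ℤ) ≤ (m' / 2 : ℕ) := by
    exact_mod_cast (Nat.div_le_div_left (by norm_num) (by norm_num) : m' / 16 ≤ m' / 2)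
  obtain ⟨W', hW', hW'o, hW'e⟩ := A.exists_inwardBody_bent hhi hm' h2 hN (r := r) (Bot := Bot) (Top := Top)
    ⟨by omega, hBot.2⟩ ⟨by omega, hTop.2⟩ hBN hTN hloN Ha hsa hya hHa hHao Vb hpb hqb hVb hVbo Hc hsc hyc hHc hHco
  obtain ⟨a', b', u', V', P', hab', hV', hV'o, hu', hP', hP'o, hV'V₁, hP's⟩ :=
    exists_inwardFence_R_rows hm' (X := (m' : ℤ) + (m' / 2 : ℕ)) (by omega) Ha hsa hya hHa hHao H₀ hs₀ hy₀ hH₀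
      hH₀o V₀ hp₀ hq₀ hV₀ hV₀o V₁ hp₁ hq₁ hV₁ hV₁o
  refine ⟨A.ofInnerPieces W' ⟨hsa, by omega, by omega⟩ hW' hW'o V' P' hab' hV' hV'o hu' hP' hP'o, fun e he => ?_⟩
  -- the edge carrier of the rebuilt arm: new body, old outer fence and attaching walk, new inner pieces
  rcases he with he | he | he | he | he
  · exact (hW'e e he).imp_right fun h v hv => ⟨by have := (h v hv).1; omega, (h v hv).2⟩
  · exact Or.inl (Or.inr (Or.inl he))
  · exact Or.inl (Or.inr (Or.inr (Or.inl he)))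
  · refine Or.inr fun v hv => ?_
    have hv' := hV'V₁ v (forall_mem_support_of_mem_edges _ he v hv)
    obtain ⟨h0, h0', h1, h1'⟩ := hV₁ v hv'
    exact ⟨by omega, by omega, by omega, by omega⟩
  · refine Or.inr fun v hv => ?_
    rcases hP's v (forall_mem_support_of_mem_edges _ he v hv) with h | h | h
    · obtain ⟨h0, h0', h1, h1'⟩ := hHa v h
      exact ⟨by omega, by omega, by omega, by omega⟩
    · obtain ⟨h0, h0', h1, h1'⟩ := hV₀ v h
      exact ⟨by omega, by omega, by omega, by omega⟩
    · obtain ⟨h0, h0', h1, h1'⟩ := hH₀ v h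
      exact ⟨by omega, by omega, by omega, by omega⟩

/-! ### Location of the carrier of a fenced right arm -/

/-- **Where the carrier of a fenced right arm lives**: in the annulus `A_{m,N}` (body), in the
columns `x₀ ≥ N - N/8 + 1` (outer fence and attaching walk), or in the box
`[m - m/8, ∞) × [lo - m/8 + 1, hi + m/8 - 1]` (inner fence and attaching walk). [folklore] -/
theorem ZdSepOpenArmR.carrier_loc (A : ZdSepOpenArmR ω m N lo hi lo' hi') (hm : 64 ≤ m) :
    ∀ v ∈ A.carrier, v ∈ sqAnnulus m N ∨ (N : ℤ) - (N / 8 : ℕ) + 1 ≤ v 0 ∨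
      ((m : ℤ) - (m / 8 : ℕ) ≤ v 0 ∧ lo - (m / 8 : ℕ) + 1 ≤ v 1 ∧ v 1 ≤ hi + (m / 8 : ℕ) - 1) := by
  have hx := A.hx
  have hz := A.hz
  have h64 : ((m / 64 : ℕ) : ℤ) + 1 ≤ (m / 8 : ℕ) := by
    have : m / 64 + 1 ≤ m / 8 := by omega
    exact_mod_cast this
  intro v hv
  rcases hv with hv | hv | hv | hv | hv
  · exact Or.inl (A.hW v hv)
  · exact Or.inr (Or.inl (by have := (A.hV v hv).1; omega))
  · have h0 := (A.hP v hv).1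
    have b0 := abs_le.1 (show |v 0 - A.z 0| ≤ (N / 8 : ℕ) - 1 by omega)
    exact Or.inr (Or.inl (by omega))
  · obtain ⟨a0, -, a1⟩ := A.hV' v hv
    have b1 := abs_le.1 a1
    exact Or.inr (Or.inr ⟨a0, by omega, by omega⟩)
  · obtain ⟨a0, a1⟩ := A.hP' v hv
    have b0 := abs_le.1 (show |v 0 - A.x 0| ≤ (m / 8 : ℕ) - 1 by omega)
    have b1 := abs_le.1 (show |v 1 - A.x 1| ≤ (m / 8 : ℕ) - 1 by omega)
    exact Or.inr (Or.inr ⟨by omega, by omega, by omega⟩)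

/-! ### The extension events of the two right arms -/

section Events

/-- **The six open extension events of the upper right arm `R⁺`** inside the hole `B(m-1)`: the thin
corridor `[m', m'+m'/2] × [m'/4, m'/4 + m'/64]`, the tall joint `[m'+m'/4, m'+m'/2] × [m'/4 - m'/64, m/4 + m/64]`,
the thin corridor `[m'+m'/4, m-1] × [m/4, m/4 + m/64]` up to the old inner fence, and the short
crossing, connector and fence-box crossing of the new inner fence. [cite: Nolin2008, §4.3 Prop. 12 (i) (arXiv 0711.4948: Prop. 11 (i))] -/
def inwardRpEvents (m m' : ℕ) : Set (BondConfig (Site 2)) :=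
  lrCrossingAt ![(m' : ℤ), ((m' / 4 : ℕ) : ℤ)] (m' / 2) (m' / 64) ∩
    (tbCrossingAt' ![(m' : ℤ) + (m' / 4 : ℕ), (((m' / 4 : ℕ) : ℤ) - ((m' / 64 : ℕ) : ℤ))] (m' / 2 - m' / 4) (((((m / 4 : ℕ) : ℤ) + ((m / 64 : ℕ) : ℤ)) - (((m' / 4 : ℕ) : ℤ) - ((m' / 64 : ℕ) : ℤ))).toNat) ∩
      (lrCrossingAt ![(m' : ℤ) + (m' / 4 : ℕ), ((m / 4 : ℕ) : ℤ)] (m - 1 - m' - m' / 4) (m / 64) ∩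
        (lrCrossingAt ![(m' : ℤ) - (m' / 8 : ℕ) + 1, ((m' / 4 : ℕ) : ℤ)] (m' / 8 - 1 + m' / 16) (m' / 64) ∩
          (tbCrossingAt' ![(m' : ℤ) + 1, ((m' / 4 : ℕ) : ℤ) - ((m' / 64 : ℕ) : ℤ)] (m' / 16 - 1) (3 * (m' / 64)) ∩
            tbCrossingAt' ![(m' : ℤ) - (m' / 8 : ℕ) + 1, ((m' / 4 : ℕ) : ℤ) - ((m' / 64 : ℕ) : ℤ)] (m' / 8 - 2) (3 * (m' / 64))))))

/-- **The six open extension events of the lower right arm `R⁻`** (mirror image in the rows; the tall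
joint spans the rows `[-(m/4 + m/64), -(m'/4 + m'/64) + 2·m'/64]`). [cite: Nolin2008, §4.3 Prop. 12 (i) (arXiv 0711.4948: Prop. 11 (i))] -/
def inwardRmEvents (m m' : ℕ) : Set (BondConfig (Site 2)) :=
  lrCrossingAt ![(m' : ℤ), (-(((m' / 4 : ℕ) : ℤ) + ((m' / 64 : ℕ) : ℤ)))] (m' / 2) (m' / 64) ∩
    (tbCrossingAt' ![(m' : ℤ) + (m' / 4 : ℕ), (-(((m / 4 : ℕ) : ℤ) + ((m / 64 : ℕ) : ℤ)))] (m' / 2 - m' / 4) ((((-(((m' / 4 : ℕ) : ℤ) + ((m' / 64 : ℕ) : ℤ))) + 2 * ((m' / 64 : ℕ) : ℤ)) - (-(((m / 4 : ℕ) : ℤ) + ((m / 64 : ℕ) : ℤ)))).toNat) ∩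
      (lrCrossingAt ![(m' : ℤ) + (m' / 4 : ℕ), (-(((m / 4 : ℕ) : ℤ) + ((m / 64 : ℕ) : ℤ)))] (m - 1 - m' - m' / 4) (m / 64) ∩
        (lrCrossingAt ![(m' : ℤ) - (m' / 8 : ℕ) + 1, (-(((m' / 4 : ℕ) : ℤ) + ((m' / 64 : ℕ) : ℤ)))] (m' / 8 - 1 + m' / 16) (m' / 64) ∩
          (tbCrossingAt' ![(m' : ℤ) + 1, (-(((m' / 4 : ℕ) : ℤ) + ((m' / 64 : ℕ) : ℤ))) - ((m' / 64 : ℕ) : ℤ)] (m' / 16 - 1) (3 * (m' / 64)) ∩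
            tbCrossingAt' ![(m' : ℤ) - (m' / 8 : ℕ) + 1, (-(((m' / 4 : ℕ) : ℤ) + ((m' / 64 : ℕ) : ℤ))) - ((m' / 64 : ℕ) : ℤ)] (m' / 8 - 2) (3 * (m' / 64))))))

/-- The pairs read by `inwardRpEvents`. [folklore] -/
def inwardRpPairs (m m' : ℕ) : Finset (Sym2 (Site 2)) :=
  ((rectangle (m' / 2) (m' / 64)).image (· + (![(m' : ℤ), ((m' / 4 : ℕ) : ℤ)] : Site 2))).sym2 ∪
    (((rectangle (m' / 2 - m' / 4) (((((m / 4 : ℕ) : ℤ) + ((m / 64 : ℕ) : ℤ)) - (((m' / 4 : ℕ) : ℤ) - ((m' / 64 : ℕ) : ℤ))).toNat)).image (· + (![(m' : ℤ) + (m' / 4 : ℕ), (((m' / 4 : ℕ) : ℤ) - ((m' / 64 : ℕ) : ℤ))] : Site 2))).sym2 ∪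
      (((rectangle (m - 1 - m' - m' / 4) (m / 64)).image (· + (![(m' : ℤ) + (m' / 4 : ℕ), ((m / 4 : ℕ) : ℤ)] : Site 2))).sym2 ∪
        (((rectangle (m' / 8 - 1 + m' / 16) (m' / 64)).image (· + (![(m' : ℤ) - (m' / 8 : ℕ) + 1, ((m' / 4 : ℕ) : ℤ)] : Site 2))).sym2 ∪
          (((rectangle (m' / 16 - 1) (3 * (m' / 64))).image (· + (![(m' : ℤ) + 1, ((m' / 4 : ℕ) : ℤ) - ((m' / 64 : ℕ) : ℤ)] : Site 2))).sym2 ∪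
            ((rectangle (m' / 8 - 2) (3 * (m' / 64))).image (· + (![(m' : ℤ) - (m' / 8 : ℕ) + 1, ((m' / 4 : ℕ) : ℤ) - ((m' / 64 : ℕ) : ℤ)] : Site 2))).sym2))))

/-- The pairs read by `inwardRmEvents`. [folklore] -/
def inwardRmPairs (m m' : ℕ) : Finset (Sym2 (Site 2)) :=
  ((rectangle (m' / 2) (m' / 64)).image (· + (![(m' : ℤ), (-(((m' / 4 : ℕ) : ℤ) + ((m' / 64 : ℕ) : ℤ)))] : Site 2))).sym2 ∪
    (((rectangle (m' / 2 - m' / 4) ((((-(((m' / 4 : ℕ) : ℤ) + ((m' / 64 : ℕ) : ℤ))) + 2 * ((m' / 64 : ℕ) : ℤ)) - (-(((m / 4 : ℕ) : ℤ) + ((m / 64 : ℕ) : ℤ)))).toNat)).image (· + (![(m' : ℤ) + (m' / 4 : ℕ), (-(((m / 4 : ℕ) : ℤ) + ((m / 64 : ℕ) : ℤ)))] : Site 2))).sym2 ∪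
      (((rectangle (m - 1 - m' - m' / 4) (m / 64)).image (· + (![(m' : ℤ) + (m' / 4 : ℕ), (-(((m / 4 : ℕ) : ℤ) + ((m / 64 : ℕ) : ℤ)))] : Site 2))).sym2 ∪
        (((rectangle (m' / 8 - 1 + m' / 16) (m' / 64)).image (· + (![(m' : ℤ) - (m' / 8 : ℕ) + 1, (-(((m' / 4 : ℕ) : ℤ) + ((m' / 64 : ℕ) : ℤ)))] : Site 2))).sym2 ∪
          (((rectangle (m' / 16 - 1) (3 * (m' / 64))).image (· + (![(m' : ℤ) + 1, (-(((m' / 4 : ℕ) : ℤ) + ((m' / 64 : ℕ) : ℤ))) - ((m' / 64 : ℕ) : ℤ)] : Site 2))).sym2 ∪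
            ((rectangle (m' / 8 - 2) (3 * (m' / 64))).image (· + (![(m' : ℤ) - (m' / 8 : ℕ) + 1, (-(((m' / 4 : ℕ) : ℤ) + ((m' / 64 : ℕ) : ℤ))) - ((m' / 64 : ℕ) : ℤ)] : Site 2))).sym2))))

/-- The `R⁺` extension events are increasing. [folklore] -/
theorem isUpperSet_inwardRpEvents (m m' : ℕ) : IsUpperSet (inwardRpEvents m m') :=
  (isUpperSet_lrCrossingAt _ _ _).inter ((isUpperSet_tbCrossingAt' _ _ _).inter ((isUpperSet_lrCrossingAt _ _ _).inter
    ((isUpperSet_lrCrossingAt _ _ _).inter ((isUpperSet_tbCrossingAt' _ _ _).inter (isUpperSet_tbCrossingAt' _ _ _)))))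

/-- The `R⁻` extension events are increasing. [folklore] -/
theorem isUpperSet_inwardRmEvents (m m' : ℕ) : IsUpperSet (inwardRmEvents m m') :=
  (isUpperSet_lrCrossingAt _ _ _).inter ((isUpperSet_tbCrossingAt' _ _ _).inter ((isUpperSet_lrCrossingAt _ _ _).inter
    ((isUpperSet_lrCrossingAt _ _ _).inter ((isUpperSet_tbCrossingAt' _ _ _).inter (isUpperSet_tbCrossingAt' _ _ _)))))

/-- The `R⁺` extension events are measurable. [folklore] -/
theorem measurableSet_inwardRpEvents (m m' : ℕ) : MeasurableSet (inwardRpEvents m m') :=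
  (measurableSet_lrCrossingAt _ _ _).inter ((measurableSet_tbCrossingAt' _ _ _).inter
    ((measurableSet_lrCrossingAt _ _ _).inter ((measurableSet_lrCrossingAt _ _ _).inter
    ((measurableSet_tbCrossingAt' _ _ _).inter (measurableSet_tbCrossingAt' _ _ _)))))

/-- The `R⁻` extension events are measurable. [folklore] -/
theorem measurableSet_inwardRmEvents (m m' : ℕ) : MeasurableSet (inwardRmEvents m m') :=
  (measurableSet_lrCrossingAt _ _ _).inter ((measurableSet_tbCrossingAt' _ _ _).inter
    ((measurableSet_lrCrossingAt _ _ _).inter ((measurableSet_lrCrossingAt _ _ _).inter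
    ((measurableSet_tbCrossingAt' _ _ _).inter (measurableSet_tbCrossingAt' _ _ _)))))

/-- The `R⁺` extension events are determined by their pairs. [folklore] -/
theorem determinedBy_inwardRpEvents (m m' : ℕ) : DeterminedBy (inwardRpEvents m m') ↑(inwardRpPairs m m') := by
  unfold inwardRpEvents inwardRpPairs lrCrossingAt tbCrossingAt'
  exact (determinedBy_openCrossing_image _ _ _ _).inter_finsetUnion
    ((determinedBy_openCrossing_image _ _ _ _).inter_finsetUnion
    ((determinedBy_openCrossing_image _ _ _ _).inter_finsetUnion
    ((determinedBy_openCrossing_image _ _ _ _).inter_finsetUnion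
    ((determinedBy_openCrossing_image _ _ _ _).inter_finsetUnion
    (determinedBy_openCrossing_image _ _ _ _)))))

/-- The `R⁻` extension events are determined by their pairs. [folklore] -/
theorem determinedBy_inwardRmEvents (m m' : ℕ) : DeterminedBy (inwardRmEvents m m') ↑(inwardRmPairs m m') := by
  unfold inwardRmEvents inwardRmPairs lrCrossingAt tbCrossingAt'
  exact (determinedBy_openCrossing_image _ _ _ _).inter_finsetUnion
    ((determinedBy_openCrossing_image _ _ _ _).inter_finsetUnion
    ((determinedBy_openCrossing_image _ _ _ _).inter_finsetUnion
    ((determinedBy_openCrossing_image _ _ _ _).inter_finsetUnion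
    ((determinedBy_openCrossing_image _ _ _ _).inter_finsetUnion
    (determinedBy_openCrossing_image _ _ _ _)))))

/-! ### The deterministic step -/

/-- Arithmetic of the `R⁺` extension. [folklore] -/
private theorem extRp_arith (hm' : 64 ≤ m') (h2 : 2 * m' ≤ m) (h4 : m ≤ 4 * m') (hN : 2 * m ≤ N) :
    (((((m / 4 : ℕ) : ℤ) + ((m / 64 : ℕ) : ℤ)) - (((m' / 4 : ℕ) : ℤ) - ((m' / 64 : ℕ) : ℤ))).toNat : ℤ) =
        (((m / 4 : ℕ) : ℤ) + ((m / 64 : ℕ) : ℤ)) - (((m' / 4 : ℕ) : ℤ) - ((m' / 64 : ℕ) : ℤ)) ∧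
      ((m' / 4 : ℕ) : ℤ) + 2 * ((m' / 64 : ℕ) : ℤ) ≤ ((m / 4 : ℕ) : ℤ) + ((m / 64 : ℕ) : ℤ) ∧
      ((m' / 4 : ℕ) : ℤ) - ((m' / 64 : ℕ) : ℤ) ≤ ((m / 4 : ℕ) : ℤ) ∧
      1 ≤ ((m' / 4 : ℕ) : ℤ) - ((m' / 64 : ℕ) : ℤ) ∧
      ((m / 4 : ℕ) : ℤ) + ((m / 64 : ℕ) : ℤ) + 1 ≤ m ∧
      |((m / 4 : ℕ) : ℤ)| + (m / 64 : ℕ) + (m / 8 : ℕ) ≤ N ∧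
      |-(((m / 4 : ℕ) : ℤ) + ((m / 64 : ℕ) : ℤ))| + (m / 64 : ℕ) + (m / 8 : ℕ) ≤ N ∧
      ((m / 4 : ℕ) : ℤ) + ((m / 64 : ℕ) : ℤ) + (m / 8 : ℕ) ≤ N := by
  have h1 : m' / 4 + 2 * (m' / 64) ≤ m / 4 + m / 64 := by omega
  have h1' : ((m' / 4 : ℕ) : ℤ) + 2 * ((m' / 64 : ℕ) : ℤ) ≤ ((m / 4 : ℕ) : ℤ) + ((m / 64 : ℕ) : ℤ) := by exact_mod_cast h1
  have h3 : m' / 64 + 1 ≤ m' / 4 := by omega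
  have h3' : ((m' / 64 : ℕ) : ℤ) + 1 ≤ (m' / 4 : ℕ) := by exact_mod_cast h3
  have h5 : m / 4 + m / 64 + 1 ≤ m := by omega
  have h5' : ((m / 4 : ℕ) : ℤ) + ((m / 64 : ℕ) : ℤ) + 1 ≤ m := by exact_mod_cast h5
  have h6 : m / 4 + 2 * (m / 64) + m / 8 ≤ N := by omega
  have h6' : ((m / 4 : ℕ) : ℤ) + 2 * ((m / 64 : ℕ) : ℤ) + (m / 8 : ℕ) ≤ N := by exact_mod_cast h6
  have h7 : m' / 4 ≤ m / 4 := by omega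
  have h7' : ((m' / 4 : ℕ) : ℤ) ≤ (m / 4 : ℕ) := by exact_mod_cast h7
  have h0a : (0 : ℤ) ≤ (m / 4 : ℕ) := by positivity
  have h0b : (0 : ℤ) ≤ (m / 64 : ℕ) := by positivity
  have h0c : (0 : ℤ) ≤ (m' / 64 : ℕ) := by positivity
  refine ⟨?_, h1', by linarith, by linarith, h5', ?_, ?_, by linarith⟩
  · exact Int.toNat_of_nonneg (by linarith)
  · rw [abs_of_nonneg h0a]; linarith
  · rw [abs_neg, abs_of_nonneg (by linarith)]; linarith

/-- Corridor sizes of the extension. [folklore] -/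
private theorem ext_arith (hm' : 64 ≤ m') (h2 : 2 * m' ≤ m) :
    ((m' / 2 - m' / 4 : ℕ) : ℤ) = (m' / 2 : ℕ) - (m' / 4 : ℕ) ∧
    ((m - 1 - m' - m' / 4 : ℕ) : ℤ) = (m : ℤ) - 1 - m' - (m' / 4 : ℕ) ∧
    ((m' / 8 - 1 + m' / 16 : ℕ) : ℤ) = (m' / 8 : ℕ) - 1 + (m' / 16 : ℕ) ∧
    ((m' / 16 - 1 : ℕ) : ℤ) = (m' / 16 : ℕ) - 1 ∧ ((m' / 8 - 2 : ℕ) : ℤ) = (m' / 8 : ℕ) - 2 := by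
  refine ⟨by omega, by omega, by omega, by omega, by omega⟩

set_option maxHeartbeats 1600000 in
/-- The rebuilt upper right arm `R⁺` from the old one and its six extension events.
[cite: Nolin2008, §4.3 Prop. 12 (i) and §4.4 part 2 (arXiv 0711.4948: Prop. 11 (i), p. 13)] -/
theorem exists_inwardRp (hω : ω ⊆ (zdGraph 2).edgeSet) (hm' : 64 ≤ m') (h2 : 2 * m' ≤ m) (h4 : m ≤ 4 * m')
    (hN : 2 * m ≤ N) (A : ZdSepOpenArmR ω m N (m / 4 : ℕ) ((m / 4 : ℕ) + (m / 64 : ℕ)) lo' hi')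
    (h : ω ∈ inwardRpEvents m m') :
    ∃ A' : ZdSepOpenArmR ω m' N (m' / 4 : ℕ) ((m' / 4 : ℕ) + (m' / 64 : ℕ)) lo' hi',
      ∀ e ∈ A'.edgeCarrier, e ∈ A.edgeCarrier ∨ ∀ v ∈ e, (m' : ℤ) - (m' / 8 : ℕ) ≤ v 0 ∧ v 0 + 1 ≤ m ∧
        ((m' / 4 : ℕ) : ℤ) - ((m' / 64 : ℕ) : ℤ) ≤ v 1 ∧ v 1 ≤ ((m / 4 : ℕ) : ℤ) + ((m / 64 : ℕ) : ℤ) := by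
  obtain ⟨hHa, hVb, hHc, hH₀, hV₀, hV₁⟩ := h
  obtain ⟨e1, e2, e3, e4, e5, e6, e7, e8⟩ := extRp_arith hm' h2 h4 hN
  obtain ⟨f1, f2, f3, f4, f5⟩ := ext_arith hm' h2
  obtain ⟨sa, ya, Ha, hsa, hya, hHas, hHao⟩ := exists_walk_of_mem_lrCrossingAt hω hHa
  obtain ⟨pb, qb, Vb, hpb, hqb, hVbs, hVbo⟩ := exists_walk_of_mem_tbCrossingAt hω hVb
  obtain ⟨sc, yc, Hc, hsc, hyc, hHcs, hHco⟩ := exists_walk_of_mem_lrCrossingAt hω hHc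
  obtain ⟨s₀, y₀, H₀, hs₀, hy₀, hH₀s, hH₀o⟩ := exists_walk_of_mem_lrCrossingAt hω hH₀
  obtain ⟨p₀, q₀, V₀, hp₀, hq₀, hV₀s, hV₀o⟩ := exists_walk_of_mem_tbCrossingAt hω hV₀
  obtain ⟨p₁, q₁, V₁, hp₁, hq₁, hV₁s, hV₁o⟩ := exists_walk_of_mem_tbCrossingAt hω hV₁
  simp only [Matrix.cons_val_zero, Matrix.cons_val_one] at hsa hya hHas hpb hqb hVbs hsc hyc hHcs
  simp only [Matrix.cons_val_zero, Matrix.cons_val_one] at hs₀ hy₀ hH₀s hp₀ hq₀ hV₀s hp₁ hq₁ hV₁s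
  simp only [Nat.cast_mul, Nat.cast_ofNat] at hq₀ hV₀s hq₁ hV₁s
  rw [e1] at hqb hVbs
  rw [f1] at hVbs
  rw [f2] at hyc hHcs
  rw [f3] at hy₀ hH₀s
  rw [f4] at hV₀s
  rw [f5] at hV₁s
  exact A.inward_bent rfl hm' h2 hN (r := ((m' / 4 : ℕ) : ℤ)) (Bot := ((m' / 4 : ℕ) : ℤ) - ((m' / 64 : ℕ) : ℤ))
    (Top := ((m / 4 : ℕ) : ℤ) + ((m / 64 : ℕ) : ℤ)) le_rfl le_rfl ⟨le_rfl, e3⟩ ⟨e2, le_rfl⟩ (by linarith) (by linarith) e6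
    Ha hsa hya (fun z hz => by have h := hHas z hz; exact ⟨h.1, h.2.1, h.2.2.1, h.2.2.2⟩) hHao
    Vb hpb (by linarith) (fun z hz => by have h := hVbs z hz; exact ⟨h.1, by linarith, h.2.2.1, by linarith⟩) hVbo
    Hc hsc (by linarith) (fun z hz => by have h := hHcs z hz; exact ⟨h.1, by linarith, h.2.2.1, h.2.2.2⟩) hHco
    H₀ hs₀ (by linarith) (fun z hz => by have h := hH₀s z hz; exact ⟨h.1, by linarith, h.2.2.1, h.2.2.2⟩) hH₀o
    V₀ hp₀ (by linarith) (fun z hz => by have h := hV₀s z hz; exact ⟨h.1, by linarith, h.2.2.1, by linarith⟩) hV₀o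
    V₁ hp₁ (by linarith) (fun z hz => by have h := hV₁s z hz; exact ⟨h.1, by linarith, h.2.2.1, by linarith⟩) hV₁o

/-- Arithmetic of the `R⁻` extension. [folklore] -/
private theorem extRm_arith (hm' : 64 ≤ m') (h2 : 2 * m' ≤ m) (h4 : m ≤ 4 * m') (hN : 2 * m ≤ N) :
    ((((-(((m' / 4 : ℕ) : ℤ) + ((m' / 64 : ℕ) : ℤ))) + 2 * ((m' / 64 : ℕ) : ℤ)) -
        (-(((m / 4 : ℕ) : ℤ) + ((m / 64 : ℕ) : ℤ)))).toNat : ℤ) =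
      ((-(((m' / 4 : ℕ) : ℤ) + ((m' / 64 : ℕ) : ℤ))) + 2 * ((m' / 64 : ℕ) : ℤ)) - (-(((m / 4 : ℕ) : ℤ) + ((m / 64 : ℕ) : ℤ))) ∧
      ((m' / 4 : ℕ) : ℤ) + 2 * ((m' / 64 : ℕ) : ℤ) ≤ ((m / 4 : ℕ) : ℤ) + ((m / 64 : ℕ) : ℤ) ∧
      ((m' / 4 : ℕ) : ℤ) - ((m' / 64 : ℕ) : ℤ) ≤ ((m / 4 : ℕ) : ℤ) ∧
      1 ≤ ((m' / 4 : ℕ) : ℤ) - ((m' / 64 : ℕ) : ℤ) ∧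
      ((m / 4 : ℕ) : ℤ) + ((m / 64 : ℕ) : ℤ) + 1 ≤ m ∧
      |-(((m / 4 : ℕ) : ℤ) + ((m / 64 : ℕ) : ℤ))| + (m / 64 : ℕ) + (m / 8 : ℕ) ≤ N ∧
      ((m / 4 : ℕ) : ℤ) + ((m / 64 : ℕ) : ℤ) + (m / 8 : ℕ) ≤ N := by
  obtain ⟨-, e2, e3, e4, e5, -, e7, e8⟩ := extRp_arith hm' h2 h4 hN
  refine ⟨Int.toNat_of_nonneg (by linarith), e2, e3, e4, e5, e7, e8⟩

set_option maxHeartbeats 1600000 in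
/-- The rebuilt lower right arm `R⁻` from the old one and its six extension events.
[cite: Nolin2008, §4.3 Prop. 12 (i) and §4.4 part 2 (arXiv 0711.4948: Prop. 11 (i), p. 13)] -/
theorem exists_inwardRm (hω : ω ⊆ (zdGraph 2).edgeSet) (hm' : 64 ≤ m') (h2 : 2 * m' ≤ m) (h4 : m ≤ 4 * m')
    (hN : 2 * m ≤ N)
    (A : ZdSepOpenArmR ω m N (-((m / 4 : ℕ) + (m / 64 : ℕ) : ℤ)) (-(m / 4 : ℕ)) lo' hi')
    (h : ω ∈ inwardRmEvents m m') :
    ∃ A' : ZdSepOpenArmR ω m' N (-((m' / 4 : ℕ) + (m' / 64 : ℕ) : ℤ)) (-(m' / 4 : ℕ)) lo' hi',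
      ∀ e ∈ A'.edgeCarrier, e ∈ A.edgeCarrier ∨ ∀ v ∈ e, (m' : ℤ) - (m' / 8 : ℕ) ≤ v 0 ∧ v 0 + 1 ≤ m ∧
        -(((m / 4 : ℕ) : ℤ) + ((m / 64 : ℕ) : ℤ)) ≤ v 1 ∧
          v 1 ≤ -(((m' / 4 : ℕ) : ℤ) + ((m' / 64 : ℕ) : ℤ)) + 2 * ((m' / 64 : ℕ) : ℤ) := by
  obtain ⟨hHa, hVb, hHc, hH₀, hV₀, hV₁⟩ := h
  obtain ⟨e1, e2, e3, e4, e5, e7, e8⟩ := extRm_arith hm' h2 h4 hN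
  obtain ⟨f1, f2, f3, f4, f5⟩ := ext_arith hm' h2
  have h0a : (0 : ℤ) ≤ (m / 4 : ℕ) := by positivity
  have h0b : (0 : ℤ) ≤ (m / 64 : ℕ) := by positivity
  have h0c : (0 : ℤ) ≤ (m' / 64 : ℕ) := by positivity
  obtain ⟨sa, ya, Ha, hsa, hya, hHas, hHao⟩ := exists_walk_of_mem_lrCrossingAt hω hHa
  obtain ⟨pb, qb, Vb, hpb, hqb, hVbs, hVbo⟩ := exists_walk_of_mem_tbCrossingAt hω hVb
  obtain ⟨sc, yc, Hc, hsc, hyc, hHcs, hHco⟩ := exists_walk_of_mem_lrCrossingAt hω hHc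
  obtain ⟨s₀, y₀, H₀, hs₀, hy₀, hH₀s, hH₀o⟩ := exists_walk_of_mem_lrCrossingAt hω hH₀
  obtain ⟨p₀, q₀, V₀, hp₀, hq₀, hV₀s, hV₀o⟩ := exists_walk_of_mem_tbCrossingAt hω hV₀
  obtain ⟨p₁, q₁, V₁, hp₁, hq₁, hV₁s, hV₁o⟩ := exists_walk_of_mem_tbCrossingAt hω hV₁
  simp only [Matrix.cons_val_zero, Matrix.cons_val_one] at hsa hya hHas hpb hqb hVbs hsc hyc hHcs
  simp only [Matrix.cons_val_zero, Matrix.cons_val_one] at hs₀ hy₀ hH₀s hp₀ hq₀ hV₀s hp₁ hq₁ hV₁s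
  simp only [Nat.cast_mul, Nat.cast_ofNat] at hq₀ hV₀s hq₁ hV₁s
  rw [e1] at hqb hVbs
  rw [f1] at hVbs
  rw [f2] at hyc hHcs
  rw [f3] at hy₀ hH₀s
  rw [f4] at hV₀s
  rw [f5] at hV₁s
  exact A.inward_bent (by ring) hm' h2 hN (r := -(((m' / 4 : ℕ) : ℤ) + ((m' / 64 : ℕ) : ℤ)))
    (Bot := -(((m / 4 : ℕ) : ℤ) + ((m / 64 : ℕ) : ℤ)))
    (Top := -(((m' / 4 : ℕ) : ℤ) + ((m' / 64 : ℕ) : ℤ)) + 2 * ((m' / 64 : ℕ) : ℤ))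
    (lo₁ := -(((m' / 4 : ℕ) : ℤ) + ((m' / 64 : ℕ) : ℤ))) (hi₁ := -((m' / 4 : ℕ) : ℤ))
    le_rfl (by linarith) ⟨by linarith, by linarith⟩ ⟨le_rfl, by linarith⟩
    (by linarith) (by linarith) e7
    Ha hsa hya (fun z hz => by have h := hHas z hz; exact ⟨h.1, h.2.1, h.2.2.1, h.2.2.2⟩) hHao
    Vb hpb (by linarith) (fun z hz => by have h := hVbs z hz; exact ⟨h.1, by linarith, h.2.2.1, by linarith⟩) hVbo
    Hc hsc (by linarith) (fun z hz => by have h := hHcs z hz; exact ⟨h.1, by linarith, h.2.2.1, h.2.2.2⟩) hHco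
    H₀ hs₀ (by linarith) (fun z hz => by have h := hH₀s z hz; exact ⟨h.1, by linarith, h.2.2.1, h.2.2.2⟩) hH₀o
    V₀ hp₀ (by linarith) (fun z hz => by have h := hV₀s z hz; exact ⟨h.1, by linarith, h.2.2.1, by linarith⟩) hV₀o
    V₁ hp₁ (by linarith) (fun z hz => by have h := hV₁s z hz; exact ⟨h.1, by linarith, h.2.2.1, by linarith⟩) hV₁o

/-- The rebuilt left arm from the left-arm components of `inwardOpenEvents` (the block of
`mem_zdFourArmSep_of_mem_inward`, isolated). [cite: Nolin2008, §4.3 Prop. 12 (i) (arXiv 0711.4948: Prop. 11 (i))] -/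
theorem nonempty_inwardL (hω : ω ⊆ (zdGraph 2).edgeSet) (hm' : 64 ≤ m') (h2 : 2 * m' ≤ m) (hN : 2 * m ≤ N)
    (BL : ZdSepOpenArmL ω m N 0 (m / 64 : ℕ) lo' hi')
    (hHL : ω ∈ lrCrossingAt ![-((m : ℤ) - 1), 0] (m - 1 - m') (m' / 64))
    (hH₀L : ω ∈ lrCrossingAt ![-((m' : ℤ) + (m' / 16 : ℕ)), 0] (m' / 8 - 1 + m' / 16) (m' / 64))
    (hV₀L : ω ∈ tbCrossingAt' ![-((m' : ℤ) + (m' / 16 : ℕ)), -((m' / 64 : ℕ) : ℤ)] (m' / 16 - 1) (3 * (m' / 64)))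
    (hV₁L : ω ∈ tbCrossingAt' ![-(m' : ℤ) + 1, -((m' / 64 : ℕ) : ℤ)] (m' / 8 - 2) (3 * (m' / 64))) :
    Nonempty (ZdSepOpenArmL ω m' N 0 (m' / 64 : ℕ) lo' hi') := by
  obtain ⟨s, y, H, hs, hy, hHs, hHo⟩ := exists_walk_of_mem_lrCrossingAt hω hHL
  obtain ⟨s₀, y₀, H₀, hs₀, hy₀, hH₀s, hH₀o⟩ := exists_walk_of_mem_lrCrossingAt hω hH₀L
  obtain ⟨p₀, q₀, V₀, hp₀, hq₀, hV₀s, hV₀o⟩ := exists_walk_of_mem_tbCrossingAt hω hV₀L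
  obtain ⟨p₁, q₁, V₁, hp₁, hq₁, hV₁s, hV₁o⟩ := exists_walk_of_mem_tbCrossingAt hω hV₁L
  simp only [Matrix.cons_val_zero, Matrix.cons_val_one] at hs hy hHs hs₀ hy₀ hH₀s
  simp only [Matrix.cons_val_zero, Matrix.cons_val_one] at hp₀ hq₀ hV₀s hp₁ hq₁ hV₁s
  exact BL.inward hm' (M := m - 1 - m') (by omega) h2 hN H.reverse (by omega) (by omega)
    (fun z hz => by
      rw [Walk.support_reverse, List.mem_reverse] at hz
      have h := hHs z hz; exact ⟨by omega, by omega, by omega, by omega⟩)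
    (fun e he => hHo e (by rwa [Walk.edges_reverse, List.mem_reverse] at he))
    H₀.reverse (by omega) (by omega)
    (fun z hz => by
      rw [Walk.support_reverse, List.mem_reverse] at hz
      have h := hH₀s z hz; exact ⟨by omega, by omega, by omega, by omega⟩)
    (fun e he => hH₀o e (by rwa [Walk.edges_reverse, List.mem_reverse] at he))
    V₀ hp₀ (by omega) (fun z hz => by have h := hV₀s z hz; exact ⟨by omega, by omega, by omega, by omega⟩) hV₀o
    V₁ hp₁ (by omega) (fun z hz => by have h := hV₁s z hz; exact ⟨by omega, by omega, by omega, by omega⟩) hV₁o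

/-- The left arm and the dual arms at the new radius from the four-arm extension events (the
blocks of `mem_zdFourArmSep_of_mem_inward`). [cite: Nolin2008, §4.3 Prop. 12 (i) (arXiv 0711.4948: Prop. 11 (i))] -/
theorem mem_LTB_of_mem_inward (hω : ω ⊆ (zdGraph 2).edgeSet) (hm' : 64 ≤ m') (h2 : 2 * m' ≤ m) (hN : 2 * m ≤ N)
    (hL : ω ∈ zdSepOpenArmL m N) (hT : ω ∈ zdSepDualArmT m N) (hB : ω ∈ zdSepDualArmB m N)
    (hopen : ω ∈ inwardOpenEvents m m') (hdual : ω ∈ inwardDualEvents m m') :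
    ω ∈ zdSepOpenArmL m' N ∧ ω ∈ zdSepDualArmT m' N ∧ ω ∈ zdSepDualArmB m' N := by
  obtain ⟨-, ⟨⟨hHL, hH₀L⟩, ⟨hV₀L, hV₁L⟩⟩⟩ := hopen
  obtain ⟨⟨⟨hK, hHd⟩, ⟨hVd, hCd⟩⟩, ⟨⟨hKB, hHdB⟩, ⟨hVdB, hCdB⟩⟩⟩ := hdual
  obtain ⟨BL⟩ := hL
  obtain ⟨T⟩ := hT
  obtain ⟨D⟩ := hB
  refine ⟨nonempty_inwardL hω hm' h2 hN BL hHL hH₀L hV₀L hV₁L, ?_, ?_⟩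
  · obtain ⟨ka, kb, K, hka, hkb, hKs, hKc⟩ := hK
    obtain ⟨xa, xb, Hd, hxa, hxb, hHds, hHdc⟩ := hHd
    obtain ⟨va, vb, Vd, hva, hvb, hVds, hVdc⟩ := hVd
    obtain ⟨ya, yb, Cd, hya, hyb, hCds, hCdc⟩ := hCd
    simp only [Matrix.cons_val_zero, Matrix.cons_val_one] at hka hkb hKs hxa hxb hHds
    simp only [Matrix.cons_val_zero, Matrix.cons_val_one] at hva hvb hVds hya hyb hCds
    exact T.inward hm' h2 hN K (by omega) (by omega)
      (fun f hf => by have h := hKs f hf; exact ⟨by omega, by omega, by omega, by omega⟩) hKc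
      Hd hxa (by omega) (fun f hf => by have h := hHds f hf; exact ⟨by omega, by omega, by omega, by omega⟩) hHdc
      Vd (by omega) (by omega) (fun f hf => by have h := hVds f hf; exact ⟨by omega, by omega, by omega, by omega⟩) hVdc
      Cd hya (by omega) (fun f hf => by have h := hCds f hf; exact ⟨by omega, by omega, by omega, by omega⟩) hCdc
  · obtain ⟨ka, kb, K, hka, hkb, hKs, hKc⟩ := hKB
    obtain ⟨xa, xb, Hd, hxa, hxb, hHds, hHdc⟩ := hHdB
    obtain ⟨va, vb, Vd, hva, hvb, hVds, hVdc⟩ := hVdB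
    obtain ⟨ya, yb, Cd, hya, hyb, hCds, hCdc⟩ := hCdB
    simp only [Matrix.cons_val_zero, Matrix.cons_val_one] at hka hkb hKs hxa hxb hHds
    simp only [Matrix.cons_val_zero, Matrix.cons_val_one] at hva hvb hVds hya hyb hCds
    exact D.inward hm' h2 hN K (by omega) (by omega)
      (fun f hf => by have h := hKs f hf; exact ⟨by omega, by omega, by omega, by omega⟩) hKc
      Hd hxa (by omega) (fun f hf => by have h := hHds f hf; exact ⟨by omega, by omega, by omega, by omega⟩) hHdc
      Vd (by omega) (by omega) (fun f hf => by have h := hVds f hf; exact ⟨by omega, by omega, by omega, by omega⟩) hVdc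
      Cd hya (by omega) (fun f hf => by have h := hCds f hf; exact ⟨by omega, by omega, by omega, by omega⟩) hCdc

/-- **Edge-disjointness of the two rebuilt right arms.** [folklore] -/
theorem disjoint_edgeCarrier_inward (hm' : 64 ≤ m') (h2 : 2 * m' ≤ m) (h4 : m ≤ 4 * m') (hN : 2 * m ≤ N)
    {lo₂' hi₂' : ℤ} {A : ZdSepOpenArmR ω m N (m / 4 : ℕ) ((m / 4 : ℕ) + (m / 64 : ℕ)) lo' hi'}
    {B : ZdSepOpenArmR ω m N (-((m / 4 : ℕ) + (m / 64 : ℕ) : ℤ)) (-(m / 4 : ℕ)) lo₂' hi₂'}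
    (hAB : Disjoint A.edgeCarrier B.edgeCarrier)
    {A' : ZdSepOpenArmR ω m' N (m' / 4 : ℕ) ((m' / 4 : ℕ) + (m' / 64 : ℕ)) lo' hi'}
    {B' : ZdSepOpenArmR ω m' N (-((m' / 4 : ℕ) + (m' / 64 : ℕ) : ℤ)) (-(m' / 4 : ℕ)) lo₂' hi₂'}
    (hA' : ∀ e ∈ A'.edgeCarrier, e ∈ A.edgeCarrier ∨ ∀ v ∈ e, (m' : ℤ) - (m' / 8 : ℕ) ≤ v 0 ∧ v 0 + 1 ≤ m ∧
        ((m' / 4 : ℕ) : ℤ) - ((m' / 64 : ℕ) : ℤ) ≤ v 1 ∧ v 1 ≤ ((m / 4 : ℕ) : ℤ) + ((m / 64 : ℕ) : ℤ))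
    (hB' : ∀ e ∈ B'.edgeCarrier, e ∈ B.edgeCarrier ∨ ∀ v ∈ e, (m' : ℤ) - (m' / 8 : ℕ) ≤ v 0 ∧ v 0 + 1 ≤ m ∧
        -(((m / 4 : ℕ) : ℤ) + ((m / 64 : ℕ) : ℤ)) ≤ v 1 ∧
          v 1 ≤ -(((m' / 4 : ℕ) : ℤ) + ((m' / 64 : ℕ) : ℤ)) + 2 * ((m' / 64 : ℕ) : ℤ)) :
    Disjoint A'.edgeCarrier B'.edgeCarrier := by
  have hm64 : 64 ≤ m := by omega
  obtain ⟨-, e2, e3, e4, e5, -, -, e8⟩ := extRp_arith hm' h2 h4 hN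
  have hm8 : ((m / 8 : ℕ) : ℤ) + 1 ≤ (m / 4 : ℕ) := by
    have : m / 8 + 1 ≤ m / 4 := by omega
    exact_mod_cast this
  have hm8' : ((m / 64 : ℕ) : ℤ) + (m / 8 : ℕ) ≤ (m / 4 : ℕ) := by
    have : m / 64 + m / 8 ≤ m / 4 := by omega
    exact_mod_cast this
  have hN8 : (m : ℤ) ≤ (N : ℤ) - (N / 8 : ℕ) := by
    have h1 : m + N / 8 ≤ N := by omega
    have h2 := (Nat.cast_le (α := ℤ)).2 h1
    simp only [Nat.cast_add] at h2
    linarith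
  have hmm' : 1 ≤ (m' : ℤ) - (m' / 8 : ℕ) := by
    have h1 : 1 + m' / 8 ≤ m' := by omega
    have h2 := (Nat.cast_le (α := ℤ)).2 h1
    simp only [Nat.cast_add, Nat.cast_one] at h2
    linarith
  have hm'm : (m' : ℤ) ≤ m := by exact_mod_cast (by omega : m' ≤ m)
  have h0c : (0 : ℤ) ≤ (m' / 64 : ℕ) := by positivity
  -- a site in one of the two extension boxes is off the other OLD arm's carrier
  have hboxA : ∀ v : Site 2, (m' : ℤ) - (m' / 8 : ℕ) ≤ v 0 → v 0 + 1 ≤ m →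
      ((m' / 4 : ℕ) : ℤ) - ((m' / 64 : ℕ) : ℤ) ≤ v 1 → v 1 ≤ ((m / 4 : ℕ) : ℤ) + ((m / 64 : ℕ) : ℤ) →
      v ∉ B.carrier := by
    intro v h0 h0' h1 h1' hv
    rcases B.carrier_loc hm64 v hv with hv | hv | ⟨-, -, hv⟩
    · obtain ⟨-, -, hbig⟩ := coords_of_mem_sqAnnulus (by omega) hv
      rcases hbig with hb | hb | hb | hb <;> linarith
    · linarith
    · linarith
  have hboxB : ∀ v : Site 2, (m' : ℤ) - (m' / 8 : ℕ) ≤ v 0 → v 0 + 1 ≤ m →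
      -(((m / 4 : ℕ) : ℤ) + ((m / 64 : ℕ) : ℤ)) ≤ v 1 →
      v 1 ≤ -(((m' / 4 : ℕ) : ℤ) + ((m' / 64 : ℕ) : ℤ)) + 2 * ((m' / 64 : ℕ) : ℤ) → v ∉ A.carrier := by
    intro v h0 h0' h1 h1' hv
    rcases A.carrier_loc hm64 v hv with hv | hv | ⟨-, hv, -⟩
    · obtain ⟨-, -, hbig⟩ := coords_of_mem_sqAnnulus (by omega) hv
      rcases hbig with hb | hb | hb | hb <;> linarith
    · linarith
    · linarith
  rw [Set.disjoint_left]
  intro e heA heB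
  obtain ⟨v, hv⟩ : ∃ v, v ∈ e := ⟨e.out.1, Sym2.out_fst_mem e⟩
  rcases hA' e heA with hA1 | hA1 <;> rcases hB' e heB with hB1 | hB1
  · exact Set.disjoint_left.1 hAB hA1 hB1
  · obtain ⟨h0, h0', h1, h1'⟩ := hB1 v hv
    exact hboxB v h0 h0' h1 h1' (A.mem_carrier_of_mem_edgeCarrier hA1 hv)
  · obtain ⟨h0, h0', h1, h1'⟩ := hA1 v hv
    exact hboxA v h0 h0' h1 h1' (B.mem_carrier_of_mem_edgeCarrier hB1 hv)
  · obtain ⟨-, -, h1, -⟩ := hA1 v hv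
    obtain ⟨-, -, -, h1'⟩ := hB1 v hv
    linarith

/-- **Inward extension of `zdFiveArmSepE`, deterministic half.**  On a lattice configuration, the
well-separated five-arm event of `A_{m,N}` together with the eight open extension events of the
four-arm file (only those of the left arm matter), the twelve extension events of the two right
arms and the eight dual extension events gives the well-separated five-arm event of `A_{m',N}`
(`64 ≤ m'`, `2m' ≤ m ≤ 4m'`, `2m ≤ N`); the two rebuilt right arms are edge-disjoint.
[cite: Nolin2008, §4.3 Prop. 12 (i) and §4.4 part 2 (arXiv 0711.4948: Prop. 11 (i), p. 13)] [cite: KestenScalingCMP1987, §2 Lemma 5] -/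
theorem mem_zdFiveArmSepE_of_mem_inward5 (hω : ω ⊆ (zdGraph 2).edgeSet)
    (hm' : 64 ≤ m') (h2 : 2 * m' ≤ m) (h4 : m ≤ 4 * m') (hN : 2 * m ≤ N)
    (h : ω ∈ zdFiveArmSepE m N ∩
      ((inwardOpenEvents m m' ∩ (inwardRpEvents m m' ∩ inwardRmEvents m m')) ∩ inwardDualEvents m m')) :
    ω ∈ zdFiveArmSepE m' N := by
  obtain ⟨⟨⟨⟨A, B, hAB⟩, hL⟩, hT, hBt⟩, ⟨hopen, hRp, hRm⟩, hdual⟩ := h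
  obtain ⟨A', hA'⟩ := exists_inwardRp hω hm' h2 h4 hN A hRp
  obtain ⟨B', hB'⟩ := exists_inwardRm hω hm' h2 h4 hN B hRm
  obtain ⟨hL', hT', hB''⟩ := mem_LTB_of_mem_inward hω hm' h2 hN hL hT hBt hopen hdual
  exact ⟨⟨⟨A', B', disjoint_edgeCarrier_inward hm' h2 h4 hN hAB hA' hB'⟩, hL'⟩, hT', hB''⟩

end Events

end Literature.Probability.Percolation
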